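import Literature.MathematicalPhysics.QuantumFieldTheory.Balaban1983to89.B10Eq17RecursiveSystem
import Literature.MathematicalPhysics.QuantumFieldTheory.Balaban1983to89.B11Prop3Model

/-!
# `Balaban1983to89.B11Eq56RecursiveSystem` — T. Bałaban, *The variational problem and background fields in
renormalization group method for lattice gauge theories*, Commun. Math. Phys. **102** (1985) 277–309
[Balaban1985Variational], display (56) p. 286 and the sentences after it: THE RECURSIVE SYSTEM FOR THE TAYLOR TERMS
`D^{(n)}` OF THE SOLUTION `D(A′)` OF (49), AT ALL ORDERS, on the Sect. C scheme (any selector of the fixed point of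
(49)–(50), in particular `B11Prop3Model.Dfix`) — r07's generic engine `B10Eq17RecursiveSystem` §1 consumed BY NAME
with every hypothesis DISCHARGED for the scheme — and print's ORDER-THREE EXAMPLE
«D^{(3)}(A′) = C_j^{(3)}(LʲηA′) − 2C_j^{(2)}(LʲηA′, LʲηHC^{(2)}(A′))» AS AN EXACT IDENTITY OF TAYLOR TERMS

statement-level skeleton of published theorems with citation tags; proofs where landed; nothing here is a claim about
the Yang–Mills mass gap

v1.1 (r08 gen 42, 2026-08-22): DOCFIX ONLY — the p. 286 quotations of this file restored to the printed glyphs after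
re-reading the render `…-p010-x2.png` AS AN IMAGE: print carries the lattice subscript `j` on the Taylor terms of `C_j`
(«where C_j^{(n)}, D^{(n)} are homogeneous polynomials of nth order», «D^{(2)}(A′) = C_j^{(2)}(LʲηA′),
D^{(3)}(A′) = C_j^{(3)}(LʲηA′) − 2C_j^{(2)}(LʲηA′, LʲηHC^{(2)}(A′))», «from the quadratic form C_j^{(2)}(A), and
C^{(2)}(A′) = C_j^{(2)}(LʲηA′) on Λ_j») which the text layer `p0010.txt` drops (v1 quoted the text layer: «C^{(n)}»,
«C^{(2)}(LʲηA′)», «C^{(3)}(LʲηA′)», «quadratic form C^{(2)}(A′)»); the unsubscripted `C^{(2)}(A′)` inside `H C^{(2)}(A′)`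
IS print (its abbreviation «C^{(2)}(A′) = C_j^{(2)}(LʲηA′) on Λ_j»). r08 `QUOTE-AUDIT-B11.md` §C item T4 (same glyph
class as p06's `B11Eq56SeriesConcrete` v1.1 / `B11Eq44Concrete` v1.1). Declarations byte-identical.

PDF held: `paper:balaban1985-cmp102-variational-background` (journal page = PDF page + 276); p. 286 = `p0010.txt`,
read first-hand on the text layer 2026-08-22 (gen 30) and on the render
`run/shared/lean/pub/pub-balaban/b2b-balaban-ref1/pages/1985-cmp102-variational-background/…-p010-x2.png` read as an
image (gen 42; the text layer drops the subscript `j` of `C_j^{(n)}`).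

CITATION HEADER.  WHAT IS REPRODUCED: SKELETON row `B11.Eq55` ((55)–(56)) of the mega-formalization `lit-balaban`
(`run/shared/lean/pub/lit-balaban/SKELETON.md` §B11; fold owner's rows `lit-balaban-r08/ROWS-B11.md`), unit
`lit-balaban-r08` (reader/typer of block B11 = this paper), gen 30.

THE PRINT (verbatim, p. 286 [PDF 10]).  After (55) *«|D(A′)| … ≦ 4C₂|A′|²₍₋₁₎»*: *«This implies that a power series
expansion of D(A′) begins with second order terms. We can find this expression from Eq. (49) and the expansion (136)
[4] of the function C_j: C_j(LʲηA′ − LʲηHD(A′)) = Σ_{n=2}^{∞} C_j^{(n)}(LʲηA′ − LʲηH Σ_{m=2}^{∞} D^{(m)}(A′))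
= Σ_{n=2}^{∞} D^{(n)}(A′), (56) where C_j^{(n)}, D^{(n)} are homogeneous polynomials of nth order. From Eq. (56) a
sequence of recursive equations for D^{(n)} follows. It can be solved easily. For example we have on Λ_j
D^{(2)}(A′) = C_j^{(2)}(LʲηA′), D^{(3)}(A′) = C_j^{(3)}(LʲηA′) − 2C_j^{(2)}(LʲηA′, LʲηHC^{(2)}(A′)), and so on. Here
C_j^{(2)}(A′, A″) denotes a symmetric bilinear form obtained by polarization from the quadratic form C_j^{(2)}(A), and
C^{(2)}(A′) = C_j^{(2)}(LʲηA′) on Λ_j.»*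

WHAT THE TREE ALREADY HAS FOR (56) (used BY NAME, nothing re-derived): orders two and three with explicit remainder
bounds for any solution of (49) (`B11Eq56Expansion.eq56_order2/eq56_order3`, r08 gen 5); on the CONCRETE ℤᵈ carrier
of [4] the terms as slice Taylor coefficients, the convergent series and the closed third-order term
(`B11Eq56Coefficients`, `B11Eq56SeriesConcrete`, `B11Eq56ThirdTermConcrete`, p06); the scheme-level second order
«D̃⁽²⁾ = C̃⁽²⁾» as `p 2 (B, B) = q 2 (B, B)` (`B12SecondOrder267.coeff_two_Dt_eq_Ct`); and the GENERIC recursive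
system for a fixed-point equation `D(x) = C(x − H D(x))` near `0` (`B10Eq17RecursiveSystem` §1, r07 gen 20:
`hasFPowerSeriesAt_comp`, `comp_coeff_eq_of_eq_below`, `coeff_diag_eq_comp`, `coeff_two_diag` — written for the
sister sentence of [Balaban1985UV3] (17) p. 260 «More generally we can get a system of recursive equations for terms in
the expansion of D̃», and offered to this row by its author, HOME INBOX 2026-08-22T09:53:02Z).
WHAT IS NEW HERE: the recursive system AT ALL ORDERS for the Sect. C scheme of THIS paper — the hypotheses of the
generic engine DISCHARGED for every selector `D` of the fixed point of (49)–(50) on `‖A′‖ < ε₃` (the equation holds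
near `0` because the ball is open; `D(0) = 0` and `DD(0) = 0` from (55) = `B13Contraction113.bound_114`; `C(0) = 0`,
`DC(0) = 0` from (44); the EXISTENCE of a Fréchet power-series expansion of `D` at `0` from the analyticity clause of
Proposition 3 in its Fréchet form `B12LinearizAnalytic267.analyticAt_Dt`), packaged as one statement
(`recursive_system`); print's ORDER-THREE EXAMPLE «D^{(3)}(A′) = C_j^{(3)}(LʲηA′) − 2C_j^{(2)}(LʲηA′, LʲηHC^{(2)}(A′))»
as an EXACT IDENTITY OF (Fréchet) TAYLOR TERMS at the scheme level (`coeff_three_diag_of_expansions`, from the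
order-three term of a composite formal series over the four compositions of `3`, §0 — the tree had order three with
remainder bounds, `B11Eq56Expansion.eq56_order3`, and on the concrete carrier, `B11Eq56ThirdTermConcrete`); and the
instances of both for the solution-as-a-function `B11Prop3Model.Dfix` under the located Sect. C
inputs `B11Prop3Model.Inputs` plus the analyticity letter of (44) in Fréchet form ([4] Prop. 7's «analytic function»
as `AnalyticOnNhd ℂ Ct {‖Y‖ < 2c₄}`, exactly as the lineage `B12LinearizAnalytic267` / `B12SecondOrder267` /
`B11Rem287U0Analytic` takes it — `Inputs.contDiff` records complex `C¹` only, and «holomorphic on an open set of a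
complex Banach space ⟹ analytic» is in Mathlib for one variable only, `DifferentiableOn.analyticOnNhd`; the tree's
`Literature.Analysis.Complex.Osgood` names the finite-dimensional statement).

DICTIONARY.  `𝒴` = complex configurations `A′` on `Ω_j` with the norm `|·|₍₋₁₎` of (43) (print's real `A′` embed);
`𝒳` = the values of `C_j`/`D` (functions on `𝔅_k`); `Ct : 𝒴 → 𝒳`, `Ct Y = C_j(LʲηY)` (the scale `Lʲη` absorbed, as
in `B13Contraction113`/`B11Prop3Model`; so print's `C_j^{(n)}(LʲηA′)` is the order-`n` term of `Ct` at `A′`, and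
print's abbreviation «C^{(2)}(A′) = C_j^{(2)}(LʲηA′) on Λ_j» is its order-two term);
`hop : 𝒳 →ₗ[ℂ] 𝒴` = the operator `H` of (45)–(46) with `‖hop X‖ ≤ b‖X‖` (`b = B₀`), and `H : 𝒳 →L[ℂ] 𝒴` ANY
continuous version of it (`hH : ∀ X, H X = hop X`; e.g. `B11Prop3Model.Inputs.hopL`); `D : 𝒴 → 𝒳` = ANY selector
with `D A′ ∈ closedBall 0 (4C₂ε²)` and `Ct (A′ − hop (D A′)) = D A′` on `‖A′‖ < ε` — by the uniqueness of p. 286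
this is THE solution of (49) there (`B11Prop3Model.Dfix` by `Dfix_ball`/`Dfix_fix`; `B12Lineariz267.exists_Dt`; p06's
concrete `D̃`); `ε` = print's `ε₃` with «9C₂B₀ε₃ < 1» ((54)) and `3ε ≤ R` (the argument stays in the ball of (44));
print's `D^{(n)}(A′)` ↦ `p n (A′, …, A′)` for a power-series expansion `p` of `D` at `0` (`HasFPowerSeriesAt D p 0`),
`C_j^{(n)}(Lʲη·)` ↦ `q n (·, …, ·)` likewise for `Ct`; `ι := (ContinuousLinearMap.id ℂ 𝒴).fpowerSeries 0` (identity series);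
the inner configuration of (56), `LʲηA′ − LʲηH Σ_m D^{(m)}(A′)`, ↦ the formal series `ι − H·p`
(`H.compFormalMultilinearSeries p`); the middle member of (56) ↦ the composite formal series `q.comp (ι − H·p)`.

CONTENTS (theorems only; no `def`, no named `Prop` fact; 0 sorry).
* §0 BOOKKEEPING over any field `𝕜` (private [folklore] plumbing: the four compositions of `3`, bilinear sign rules),
  POLARIZATION = symmetrisation (`polarization_vec2`: print's «symmetric bilinear form obtained by polarization from the
  quadratic form»), and **`comp_coeff_three_diag`**: for `q 1 = 0` and `r 1 (y) = y`,
  `(q ∘ r) 3 (y, y, y) = q 3 (y, y, y) + q 2 (y, r 2 (y, y)) + q 2 (r 2 (y, y), y)` (the order-three equation of (56)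
  in abstract letters).
* §1 FOR EVERY PAIR OF EXPANSIONS `p` of `D` and `q` of `Ct` at `0` (no analyticity hypothesis beyond their existence):
  `fix_eventually` ((49) near `0`), `hasFDerivAt_D_zero` (`DD(0) = 0` from (55)), **`hasFPowerSeriesAt_recursive`**
  ((56) as an identity of expansions: `q ∘ (ι − H·p)` is again an expansion of `D` at `0`), **`coeff_recursion`**
  (THE RECURSION: the order-`n` term of `q ∘ (ι − H·p)` is unchanged when `p` is replaced by any series agreeing with
  it below order `n` — «a sequence of recursive equations for D^{(n)} follows»), **`coeff_diag_recursive`**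
  (`p n (A′, …, A′) = (q ∘ (ι − H·p)) n (A′, …, A′)` — the homogeneous terms `D^{(n)}(A′)` satisfy the system),
  `coeff_two_diag_of_expansions` («D^{(2)}(A′) = C_j^{(2)}(LʲηA′)» as `p 2 (A′, A′) = q 2 (A′, A′)`),
  `inner_one_diag`/`inner_two_diag` (`(ι − H·p) 1 (y) = y`, `(ι − H·p) 2 (y, y) = −H p 2 (y, y)`), and
  **`coeff_three_diag_of_expansions`** («D^{(3)}(A′) = C_j^{(3)}(LʲηA′) − 2C_j^{(2)}(LʲηA′, LʲηHC^{(2)}(A′))» as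
  `p 3 (A′, A′, A′) = q 3 (A′, A′, A′) − (q 2 (A′, H p 2 (A′, A′)) + q 2 (H p 2 (A′, A′), A′))`).
* §2 EXISTENCE OF THE EXPANSIONS from the analyticity letter of (44) in Fréchet form
  (`hCa : AnalyticOnNhd ℂ Ct {‖Y‖ < R}`): `exists_expansion_D` (with `p 0 = 0`, `p 1 = 0` — «begins with second
  order terms»), `exists_expansion_Ct`, and the package **`recursive_system`**.
* §3 THE INSTANCES FOR `B11Prop3Model.Dfix` under `B11Prop3Model.Inputs Ct hop C₂ C₃ B₀ c₄`, `9C₂B₀ε₃ < 1`,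
  `3ε₃ ≤ 2c₄`: **`dfix_recursive_system`** (`C` analytic on `‖Y‖ < 2c₄`), **`dfix_coeff_three_diag`** (for every pair
  of expansions).

HONEST SCOPE.  (i) «It can be solved easily» is formalised as the recursion SHAPE (order `n` determined by `C` and the
orders `< n` of `D`) plus the closed forms at orders two and three exactly as printed (order three: the bracket
`q 2 (A′, HB) + q 2 (HB, A′)` IS print's `2C_j^{(2)}(LʲηA′, LʲηHB)` with the symmetric polarization `C_j^{(2)}(·, ·)`,
by `polarization_vec2`); no closed form is produced for any order `n ≥ 4` («and so on»); (ii) a power-series expansion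
`p` of `D` in a Banach space is not unique beyond its diagonal values `p n (A′, …, A′)` — every statement is made for
EVERY expansion, and the homogeneous polynomial `D^{(n)}(A′)` of print is the diagonal; (iii) the convergence of
`Σ_n D^{(n)}` is the analyticity of `D` (Proposition 3, here
`B12LinearizAnalytic267.analyticAt_Dt` / concrete `B11Eq56SeriesConcrete.hasSum_DtN`), not re-derived; (iv) scheme
level: abstract complex Banach spaces with the printed letters; the lattice objects are p06's/NE9's files; «on Λ_j»
(the restriction in print's example) is not modelled.  NOT summit progress.  Mega-formalization `lit-balaban`, HOME
`run/shared/lean/pub/lit-balaban/`; imports `B10Eq17RecursiveSystem` (r07) and `B11Prop3Model` (r08 gen 6) only;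
modifies nothing.  Net new unproved facts: 0.
-/

open Metric Set Filter Topology

namespace Literature.MathematicalPhysics.QuantumFieldTheory.Balaban1983to89.B11Eq56RecursiveSystem

open B13Contraction113 (QuadAnalytic)
open B12Lineariz267 (norm_Dt_le)
open B12SecondOrder267 (hasFDerivAt_zero_of_norm_le_sq Dt_zero coeff_zero_one_Dt coeff_zero_one_Ct)
open B12LinearizAnalytic267 (analyticAt_Dt)
open B10Eq17RecursiveSystem (hasFPowerSeriesAt_comp comp_coeff_eq_of_eq_below coeff_diag_eq_comp coeff_two_diag)

/-! ## §0  Order three of a composite formal series on the diagonal (generic bookkeeping, any field `𝕜`) -/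

section OrderThree

variable {𝕜 : Type*} [NontriviallyNormedField 𝕜] {E F : Type*} [NormedAddCommGroup E] [NormedSpace 𝕜 E]
  [NormedAddCommGroup F] [NormedSpace 𝕜 F]

/-- The blocks `[1, 2]` are positive (a composition of `3`). [folklore] -/
private theorem blocks_pos_one_two : ∀ {i : ℕ}, i ∈ [1, 2] → 0 < i := by
  intro i hi
  simp only [List.mem_cons, List.not_mem_nil, or_false] at hi
  omega

/-- The blocks `[2, 1]` are positive (a composition of `3`). [folklore] -/
private theorem blocks_pos_two_one : ∀ {i : ℕ}, i ∈ [2, 1] → 0 < i := by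
  intro i hi
  simp only [List.mem_cons, List.not_mem_nil, or_false] at hi
  omega

/-- The blocks `[1, 2]` sum to `3`. [folklore] -/
private theorem blocks_sum_one_two : ([1, 2] : List ℕ).sum = 3 := by norm_num

/-- The blocks `[2, 1]` sum to `3`. [folklore] -/
private theorem blocks_sum_two_one : ([2, 1] : List ℕ).sum = 3 := by norm_num

/-- **The four compositions of `3`**: `[3]`, `[1, 2]`, `[2, 1]`, `[1, 1, 1]` (there are `2^{3−1} = 4`, Mathlib
`composition_card`) — the index set of the order-three term of a composite formal series. [folklore] -/
private theorem univ_composition_three :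
    (Finset.univ : Finset (Composition 3)) =
      {Composition.single 3 zero_lt_three, ⟨[1, 2], blocks_pos_one_two, blocks_sum_one_two⟩,
        ⟨[2, 1], blocks_pos_two_one, blocks_sum_two_one⟩, Composition.ones 3} :=
  (Finset.eq_univ_of_card _ (by rw [composition_card]; decide)).symm

/-- A bilinear term with the second argument negated: `f(a, −b) = −f(a, b)`. [folklore] -/
private theorem map_vec2_neg_snd (f : E [×2]→L[𝕜] F) (a b : E) : f ![a, -b] = -f ![a, b] := by
  have h := f.toMultilinearMap.map_update_neg ![a, b] 1 b
  have e1 : Function.update ![a, b] 1 (-b) = ![a, -b] := by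
    funext i; fin_cases i <;> simp
  have e2 : Function.update ![a, b] 1 b = ![a, b] := by
    funext i; fin_cases i <;> simp
  rw [e1, e2] at h
  exact h

/-- A bilinear term with the first argument negated: `f(−a, b) = −f(a, b)`. [folklore] -/
private theorem map_vec2_neg_fst (f : E [×2]→L[𝕜] F) (a b : E) : f ![-a, b] = -f ![a, b] := by
  have h := f.toMultilinearMap.map_update_neg ![a, b] 0 a
  have e1 : Function.update ![a, b] 0 (-a) = ![-a, b] := by
    funext i; fin_cases i <;> simp
  have e2 : Function.update ![a, b] 0 a = ![a, b] := by
    funext i; fin_cases i <;> simp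
  rw [e1, e2] at h
  exact h

/-- **Polarization** — print p. 286: *«Here C_j^{(2)}(A′, A″) denotes a symmetric bilinear form obtained by
polarization from the quadratic form C_j^{(2)}(A), and C^{(2)}(A′) = C_j^{(2)}(LʲηA′) on Λ_j.»*: for ANY continuous
bilinear `f` (symmetric or not) the polarization of its quadratic form is its symmetrisation,
`f(a + b, a + b) − f(a, a) − f(b, b) = f(a, b) + f(b, a)`; so print's `2C_j^{(2)}(A′, A″)` is
`q 2 (A′, A″) + q 2 (A″, A′)` for every expansion `q` whose quadratic term is `C_j^{(2)}`.
[cite: Balaban1985Variational, (56) p.286] -/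
theorem polarization_vec2 (f : E [×2]→L[𝕜] F) (a b : E) :
    f ![a + b, a + b] - f ![a, a] - f ![b, b] = f ![a, b] + f ![b, a] := by
  have hfst : ∀ x y z : E, f ![x + y, z] = f ![x, z] + f ![y, z] := by
    intro x y z
    have h := f.toMultilinearMap.map_update_add ![x, z] 0 x y
    have e1 : Function.update ![x, z] 0 (x + y) = ![x + y, z] := by funext i; fin_cases i <;> simp
    have e2 : Function.update ![x, z] 0 x = ![x, z] := by funext i; fin_cases i <;> simp
    have e3 : Function.update ![x, z] 0 y = ![y, z] := by funext i; fin_cases i <;> simp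
    rw [e1, e2, e3] at h
    exact h
  have hsnd : ∀ x y z : E, f ![x, y + z] = f ![x, y] + f ![x, z] := by
    intro x y z
    have h := f.toMultilinearMap.map_update_add ![x, y] 1 y z
    have e1 : Function.update ![x, y] 1 (y + z) = ![x, y + z] := by funext i; fin_cases i <;> simp
    have e2 : Function.update ![x, y] 1 y = ![x, y] := by funext i; fin_cases i <;> simp
    have e3 : Function.update ![x, y] 1 z = ![x, z] := by funext i; fin_cases i <;> simp
    rw [e1, e2, e3] at h
    exact h
  rw [hfst, hsnd, hsnd]
  abel

/-- **Order three of a composite formal series on the diagonal**: if the outer series is critical (`q 1 = 0`) and the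
inner one is tangent to the identity on the diagonal (`r 1 (y) = y`), then
`(q ∘ r) 3 (y, y, y) = q 3 (y, y, y) + q 2 (y, r 2 (y, y)) + q 2 (r 2 (y, y), y)` — the compositions `[1, 1, 1]`,
`[1, 2]`, `[2, 1]` of `3` contribute and `[3]` does not.  This is the order-three equation of the recursive system
(56) in abstract letters (print: «It can be solved easily. For example … D^{(3)}(A′) = C_j^{(3)}(LʲηA′) −
2C_j^{(2)}(LʲηA′, LʲηHC^{(2)}(A′))»), over any field `𝕜`. [cite: Balaban1985Variational, (56) p.286] -/
theorem comp_coeff_three_diag (q : FormalMultilinearSeries 𝕜 E F) (r : FormalMultilinearSeries 𝕜 E E)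
    (hq1 : q 1 = 0) (hr1 : ∀ y : E, r 1 (fun _ => y) = y) (y : E) :
    q.comp r 3 (fun _ => y) = q 3 (fun _ => y) + (q 2 ![y, r 2 fun _ => y] + q 2 ![r 2 fun _ => y, y]) := by
  have happly : ∀ c : Composition 3,
      r.applyComposition c (fun _ => y) = fun i => r (c.blocksFun i) fun _ => y := fun c => rfl
  -- the block `[3]`: killed by `q 1 = 0`
  have T1 : q.compAlongComposition r (Composition.single 3 zero_lt_three) (fun _ => y) = 0 := by
    rw [FormalMultilinearSeries.compAlongComposition_apply]
    have h0 : q (Composition.single 3 zero_lt_three).length = 0 :=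
      q.congr_zero (Composition.single_length _).symm hq1
    rw [h0, zero_apply]
  -- the blocks `[1, 1, 1]`
  have T4 : q.compAlongComposition r (Composition.ones 3) (fun _ => y) = q 3 fun _ => y := by
    rw [FormalMultilinearSeries.compAlongComposition_apply, FormalMultilinearSeries.applyComposition_ones]
    simp only [hr1]
    exact q.congr (Composition.ones_length 3) fun _ _ _ => rfl
  -- the blocks `[1, 2]`
  have T2 : q.compAlongComposition r ⟨[1, 2], blocks_pos_one_two, blocks_sum_one_two⟩ (fun _ => y) =
      q 2 ![y, r 2 fun _ => y] := by
    rw [FormalMultilinearSeries.compAlongComposition_apply, happly]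
    refine q.congr rfl fun i him hin => ?_
    match i, him, hin with
    | 0, _, _ => exact (r.congr rfl fun _ _ _ => rfl).trans (hr1 y)
    | 1, _, _ => exact r.congr rfl fun _ _ _ => rfl
    | n + 2, _, hin => exact absurd hin (by omega)
  -- the blocks `[2, 1]`
  have T3 : q.compAlongComposition r ⟨[2, 1], blocks_pos_two_one, blocks_sum_two_one⟩ (fun _ => y) =
      q 2 ![r 2 fun _ => y, y] := by
    rw [FormalMultilinearSeries.compAlongComposition_apply, happly]
    refine q.congr rfl fun i him hin => ?_
    match i, him, hin with
    | 0, _, _ => exact r.congr rfl fun _ _ _ => rfl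
    | 1, _, _ => exact (r.congr rfl fun _ _ _ => rfl).trans (hr1 y)
    | n + 2, _, hin => exact absurd hin (by omega)
  change (∑ c : Composition 3, q.compAlongComposition r c) (fun _ => y) = _
  rw [sum_apply, univ_composition_three, Finset.sum_insert (by decide),
    Finset.sum_insert (by decide), Finset.sum_insert (by decide), Finset.sum_singleton, T1, T2, T3, T4]
  abel

end OrderThree

variable {𝒳 𝒴 : Type*} [NormedAddCommGroup 𝒳] [NormedSpace ℂ 𝒳] [CompleteSpace 𝒳]
  [NormedAddCommGroup 𝒴] [NormedSpace ℂ 𝒴] [CompleteSpace 𝒴]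
  {hop : 𝒳 →ₗ[ℂ] 𝒴} {Ct : 𝒴 → 𝒳} {C₂ R b ε : ℝ} {D : 𝒴 → 𝒳}

/-! ## §1  The recursive system for every pair of expansions of `D` and `C` at `0` -/

section Expansions

omit [CompleteSpace 𝒳] [CompleteSpace 𝒴] in
/-- **Eq. (49) holds near `A′ = 0`**: for a selector `D` of the fixed point on the open ball `‖A′‖ < ε` (`ε > 0`) and
any continuous version `H` of the operator `hop`, `D A′ = C(A′ − H D(A′))` eventually at `0` — the form consumed by
the generic engine `B10Eq17RecursiveSystem`. [cite: Balaban1985Variational, (49) p.285, p.286] -/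
theorem fix_eventually (hDfix : ∀ B : 𝒴, ‖B‖ < ε → Ct (B - hop (D B)) = D B) (hε : 0 < ε)
    (H : 𝒳 →L[ℂ] 𝒴) (hH : ∀ X, H X = hop X) :
    ∀ᶠ A in 𝓝 (0 : 𝒴), D A = Ct (A - H (D A)) := by
  filter_upwards [ball_mem_nhds (0 : 𝒴) hε] with A hA
  rw [hH]
  exact (hDfix A (mem_ball_zero_iff.mp hA)).symm

omit [CompleteSpace 𝒴] in
/-- **`DD(0) = 0` from (55)**: the bound `‖D(A′)‖ ≤ 4C₂‖A′‖²` on `‖A′‖ < ε` ((55) = `B13Contraction113.bound_114`,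
here through `B12Lineariz267.norm_Dt_le`) makes `D` Fréchet-differentiable at `0` with derivative `0` — «a power series
expansion of D(A′) begins with second order terms». [cite: Balaban1985Variational, (55) p.286] -/
theorem hasFDerivAt_D_zero (hC : QuadAnalytic Ct C₂ R) (hC₂ : 0 ≤ C₂) (hb : 0 ≤ b)
    (hHop : ∀ X, ‖hop X‖ ≤ b * ‖X‖) (hq : 9 * C₂ * b * ε < 1) (hRC : 3 * ε ≤ R)
    (hDball : ∀ B : 𝒴, ‖B‖ < ε → D B ∈ closedBall (0 : 𝒳) (4 * C₂ * ε ^ 2))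
    (hDfix : ∀ B : 𝒴, ‖B‖ < ε → Ct (B - hop (D B)) = D B) (hε : 0 < ε) :
    HasFDerivAt D (0 : 𝒴 →L[ℂ] 𝒳) 0 :=
  hasFDerivAt_zero_of_norm_le_sq (C₂ := 4 * C₂) hε fun _ hB => norm_Dt_le hC hC₂ hb hHop hq hRC hDball hDfix hB

omit [CompleteSpace 𝒴] in
/-- **(56) AS AN IDENTITY OF EXPANSIONS** — *«C_j(LʲηA′ − LʲηHD(A′)) = Σ_n C_j^{(n)}(LʲηA′ − LʲηH Σ_m D^{(m)}(A′))
= Σ_n D^{(n)}(A′)»*: for every expansion `p` of `D` and `q` of `C` at `0`, the COMPOSITE formal power series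
`q ∘ (ι − H·p)` (the middle member of (56)) is again an expansion of `D` at `0` (the right member).  Generic engine
`B10Eq17RecursiveSystem.hasFPowerSeriesAt_comp`; here `D(0) = 0` is discharged by (55). [cite: Balaban1985Variational, (56) p.286] -/
theorem hasFPowerSeriesAt_recursive (hC : QuadAnalytic Ct C₂ R) (hC₂ : 0 ≤ C₂) (hb : 0 ≤ b)
    (hHop : ∀ X, ‖hop X‖ ≤ b * ‖X‖) (hq : 9 * C₂ * b * ε < 1) (hRC : 3 * ε ≤ R)
    (hDball : ∀ B : 𝒴, ‖B‖ < ε → D B ∈ closedBall (0 : 𝒳) (4 * C₂ * ε ^ 2))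
    (hDfix : ∀ B : 𝒴, ‖B‖ < ε → Ct (B - hop (D B)) = D B) (hε : 0 < ε)
    (H : 𝒳 →L[ℂ] 𝒴) (hH : ∀ X, H X = hop X)
    {p q : FormalMultilinearSeries ℂ 𝒴 𝒳} (hp : HasFPowerSeriesAt D p 0) (hq' : HasFPowerSeriesAt Ct q 0) :
    HasFPowerSeriesAt D
      (q.comp ((ContinuousLinearMap.id ℂ 𝒴).fpowerSeries 0 - H.compFormalMultilinearSeries p)) 0 :=
  hasFPowerSeriesAt_comp (fix_eventually hDfix hε H hH) (Dt_zero hC hC₂ hb hHop hq hRC hDball hDfix hε) hp hq'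

omit [CompleteSpace 𝒳] [CompleteSpace 𝒴] in
/-- **THE RECURSION — «From Eq. (56) a sequence of recursive equations for D^{(n)} follows»**: since `C` begins with
second-order terms (`q 1 = 0`, from (44) via `B12SecondOrder267.coeff_zero_one_Ct`), the order-`n` term of the
composite series `q ∘ (ι − H·p)` is unchanged when `p` is replaced by ANY series `s` agreeing with `p` in the orders
`< n`: the order-`n` equation of (56) involves `C^{(m)}`, `m ≤ n`, and `D^{(m)}`, `m < n`, only.  Generic engine
`B10Eq17RecursiveSystem.comp_coeff_eq_of_eq_below`. [cite: Balaban1985Variational, (56) p.286] -/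
theorem coeff_recursion (hC : QuadAnalytic Ct C₂ R) (hR : 0 < R) (H : 𝒳 →L[ℂ] 𝒴)
    {q : FormalMultilinearSeries ℂ 𝒴 𝒳} (hq' : HasFPowerSeriesAt Ct q 0)
    (p s : FormalMultilinearSeries ℂ 𝒴 𝒳) {n : ℕ} (hs : ∀ m < n, s m = p m) :
    q.comp ((ContinuousLinearMap.id ℂ 𝒴).fpowerSeries 0 - H.compFormalMultilinearSeries p) n =
      q.comp ((ContinuousLinearMap.id ℂ 𝒴).fpowerSeries 0 - H.compFormalMultilinearSeries s) n := by
  have hq1 : q 1 = 0 := (coeff_zero_one_Ct hC hR hq').2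
  refine comp_coeff_eq_of_eq_below hq1 fun m hm => ?_
  change (ContinuousLinearMap.id ℂ 𝒴).fpowerSeries 0 m - H.compFormalMultilinearSeries p m =
    (ContinuousLinearMap.id ℂ 𝒴).fpowerSeries 0 m - H.compFormalMultilinearSeries s m
  rw [ContinuousLinearMap.compFormalMultilinearSeries_apply, ContinuousLinearMap.compFormalMultilinearSeries_apply,
    hs m hm]

omit [CompleteSpace 𝒴] in
/-- **The homogeneous terms `D^{(n)}(A′)` satisfy the recursive system**: for every expansion `p` of `D` and `q` of
`C` at `0` and every `n`, `p n (A′, …, A′) = (q ∘ (ι − H·p)) n (A′, …, A′)` (both are `(n!)⁻¹DⁿD(0)(A′, …, A′)`).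
Generic engine `B10Eq17RecursiveSystem.coeff_diag_eq_comp`. [cite: Balaban1985Variational, (56) p.286] -/
theorem coeff_diag_recursive (hC : QuadAnalytic Ct C₂ R) (hC₂ : 0 ≤ C₂) (hb : 0 ≤ b)
    (hHop : ∀ X, ‖hop X‖ ≤ b * ‖X‖) (hq : 9 * C₂ * b * ε < 1) (hRC : 3 * ε ≤ R)
    (hDball : ∀ B : 𝒴, ‖B‖ < ε → D B ∈ closedBall (0 : 𝒳) (4 * C₂ * ε ^ 2))
    (hDfix : ∀ B : 𝒴, ‖B‖ < ε → Ct (B - hop (D B)) = D B) (hε : 0 < ε)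
    (H : 𝒳 →L[ℂ] 𝒴) (hH : ∀ X, H X = hop X)
    {p q : FormalMultilinearSeries ℂ 𝒴 𝒳} (hp : HasFPowerSeriesAt D p 0) (hq' : HasFPowerSeriesAt Ct q 0)
    (n : ℕ) (A : 𝒴) :
    p n (fun _ => A) =
      (q.comp ((ContinuousLinearMap.id ℂ 𝒴).fpowerSeries 0 - H.compFormalMultilinearSeries p)) n (fun _ => A) :=
  coeff_diag_eq_comp (fix_eventually hDfix hε H hH) (Dt_zero hC hC₂ hb hHop hq hRC hDball hDfix hε) hp hq' n A

omit [CompleteSpace 𝒴] in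
/-- **«For example we have … D^{(2)}(A′) = C_j^{(2)}(LʲηA′)»** for every pair of expansions: `p 2 (A′, A′) = q 2 (A′, A′)`
— order two of the recursion (`ι − H·p` agrees with `ι` below order `2`).  Generic engine
`B10Eq17RecursiveSystem.coeff_two_diag`, with `DD(0) = 0` discharged by (55); the same identity is
`B12SecondOrder267.coeff_two_Dt_eq_Ct` (via `D²D(0) = D²C(0)`, which needs `C` analytic) — here no analyticity of `C`
beyond the expansion `q` at `0` is used. [cite: Balaban1985Variational, (56) p.286] -/
theorem coeff_two_diag_of_expansions (hC : QuadAnalytic Ct C₂ R) (hC₂ : 0 ≤ C₂) (hb : 0 ≤ b)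
    (hHop : ∀ X, ‖hop X‖ ≤ b * ‖X‖) (hq : 9 * C₂ * b * ε < 1) (hRC : 3 * ε ≤ R)
    (hDball : ∀ B : 𝒴, ‖B‖ < ε → D B ∈ closedBall (0 : 𝒳) (4 * C₂ * ε ^ 2))
    (hDfix : ∀ B : 𝒴, ‖B‖ < ε → Ct (B - hop (D B)) = D B) (hε : 0 < ε)
    (H : 𝒳 →L[ℂ] 𝒴) (hH : ∀ X, H X = hop X)
    {p q : FormalMultilinearSeries ℂ 𝒴 𝒳} (hp : HasFPowerSeriesAt D p 0) (hq' : HasFPowerSeriesAt Ct q 0)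
    (A : 𝒴) : p 2 (fun _ => A) = q 2 (fun _ => A) :=
  coeff_two_diag (H := H) (fix_eventually hDfix hε H hH) (Dt_zero hC hC₂ hb hHop hq hRC hDball hDfix hε)
    (hasFDerivAt_D_zero hC hC₂ hb hHop hq hRC hDball hDfix hε) hp hq' A

omit [CompleteSpace 𝒳] [CompleteSpace 𝒴] in
/-- The inner series `ι − H·p` of (56) is tangent to the identity on the diagonal when `p 1 = 0`:
`(ι − H·p) 1 (y) = y`. [cite: Balaban1985Variational, (56) p.286] -/
theorem inner_one_diag (H : 𝒳 →L[ℂ] 𝒴) {p : FormalMultilinearSeries ℂ 𝒴 𝒳} (hp1 : p 1 = 0) (y : 𝒴) :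
    ((ContinuousLinearMap.id ℂ 𝒴).fpowerSeries 0 - H.compFormalMultilinearSeries p) 1 (fun _ => y) = y := by
  change (ContinuousLinearMap.id ℂ 𝒴).fpowerSeries 0 1 (fun _ => y) - H (p 1 fun _ => y) = y
  rw [hp1]
  simp

omit [CompleteSpace 𝒳] [CompleteSpace 𝒴] in
/-- The order-two term of the inner series `ι − H·p` of (56) is `−H D^{(2)}`: `(ι − H·p) 2 (y, y) = −H (p 2 (y, y))`
(the identity series has no terms of order `≥ 2`). [cite: Balaban1985Variational, (56) p.286] -/
theorem inner_two_diag (H : 𝒳 →L[ℂ] 𝒴) (p : FormalMultilinearSeries ℂ 𝒴 𝒳) (y : 𝒴) :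
    ((ContinuousLinearMap.id ℂ 𝒴).fpowerSeries 0 - H.compFormalMultilinearSeries p) 2 (fun _ => y) =
      -H (p 2 fun _ => y) := by
  change (ContinuousLinearMap.id ℂ 𝒴).fpowerSeries 0 2 (fun _ => y) - H (p 2 fun _ => y) = _
  have h2 : (ContinuousLinearMap.id ℂ 𝒴).fpowerSeries 0 2 = 0 := ContinuousLinearMap.fpowerSeries_apply_add_two _ _ 0
  rw [h2, zero_apply, zero_sub]

omit [CompleteSpace 𝒴] in
/-- **«… D^{(3)}(A′) = C_j^{(3)}(LʲηA′) − 2C_j^{(2)}(LʲηA′, LʲηHC^{(2)}(A′)), and so on»** — ORDER THREE OF THE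
RECURSIVE SYSTEM AS AN EXACT IDENTITY OF TAYLOR TERMS on the Sect. C scheme: for every expansion `p` of `D` and `q` of
`C` at `0`, `p 3 (A′, A′, A′) = q 3 (A′, A′, A′) − (q 2 (A′, H B) + q 2 (H B, A′))` with `B = p 2 (A′, A′)`
(`= q 2 (A′, A′)`, print's `C^{(2)}(A′) = C_j^{(2)}(LʲηA′)`, by `coeff_two_diag_of_expansions`); the bracket is print's
`2C_j^{(2)}(LʲηA′, LʲηHB)` with the SYMMETRIC polarization `C_j^{(2)}(·, ·)` of the quadratic form
(`polarization_vec2`).  From the order-three term of the composite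
series (`comp_coeff_three_diag`: the compositions `[1,1,1]`, `[1,2]`, `[2,1]` of `3`) with `q 1 = 0` from (44) and
`p 1 = 0` from (55); no analyticity of `C` beyond the expansion `q` is used.  (Remainder forms of the same statement:
`B11Eq56Expansion.eq56_order3`; concrete carrier: `B11Eq56ThirdTermConcrete`.) [cite: Balaban1985Variational, (56) p.286] -/
theorem coeff_three_diag_of_expansions (hC : QuadAnalytic Ct C₂ R) (hC₂ : 0 ≤ C₂) (hb : 0 ≤ b)
    (hHop : ∀ X, ‖hop X‖ ≤ b * ‖X‖) (hq : 9 * C₂ * b * ε < 1) (hRC : 3 * ε ≤ R)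
    (hDball : ∀ B : 𝒴, ‖B‖ < ε → D B ∈ closedBall (0 : 𝒳) (4 * C₂ * ε ^ 2))
    (hDfix : ∀ B : 𝒴, ‖B‖ < ε → Ct (B - hop (D B)) = D B) (hε : 0 < ε)
    (H : 𝒳 →L[ℂ] 𝒴) (hH : ∀ X, H X = hop X)
    {p q : FormalMultilinearSeries ℂ 𝒴 𝒳} (hp : HasFPowerSeriesAt D p 0) (hq' : HasFPowerSeriesAt Ct q 0)
    (A : 𝒴) :
    p 3 (fun _ => A) = q 3 (fun _ => A) - (q 2 ![A, H (p 2 fun _ => A)] + q 2 ![H (p 2 fun _ => A), A]) := by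
  have hR : 0 < R := by linarith
  have hq1 : q 1 = 0 := (coeff_zero_one_Ct hC hR hq').2
  have hp1 : p 1 = 0 :=
    B12SecondOrder267.coeff_one_eq_zero hp (hasFDerivAt_D_zero hC hC₂ hb hHop hq hRC hDball hDfix hε).fderiv
  rw [coeff_diag_recursive hC hC₂ hb hHop hq hRC hDball hDfix hε H hH hp hq' 3 A,
    comp_coeff_three_diag q _ hq1 (inner_one_diag H hp1) A, inner_two_diag H p A, map_vec2_neg_snd, map_vec2_neg_fst]
  abel

end Expansions

/-! ## §2  Existence of the expansions (the analyticity letter of (44) in Fréchet form) and the package -/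

section Package

omit [CompleteSpace 𝒳] [CompleteSpace 𝒴] in
/-- `C` HAS an expansion at `0`, and every such expansion begins with second-order terms (`q 0 = 0`, `q 1 = 0`, from
the quadratic bound (44)). [cite: Balaban1985Variational, (44) p.285, (56) p.286] -/
theorem exists_expansion_Ct (hC : QuadAnalytic Ct C₂ R) (hCa : AnalyticOnNhd ℂ Ct {Y : 𝒴 | ‖Y‖ < R})
    (hR : 0 < R) :
    ∃ q : FormalMultilinearSeries ℂ 𝒴 𝒳, HasFPowerSeriesAt Ct q 0 ∧ q 0 = 0 ∧ q 1 = 0 := by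
  have h0 : (0 : 𝒴) ∈ {Y : 𝒴 | ‖Y‖ < R} := by simp [hR]
  obtain ⟨q, hq'⟩ := hCa 0 h0
  exact ⟨q, hq', coeff_zero_one_Ct hC hR hq'⟩

/-- **«a power series expansion of D(A′) begins with second order terms»**: `D` HAS a (Fréchet) power-series expansion
at `0` — the analyticity clause of Proposition 3 in Fréchet form, `B12LinearizAnalytic267.analyticAt_Dt` (analytic
implicit function theorem) — and every such expansion has `p 0 = 0`, `p 1 = 0`. [cite: Balaban1985Variational, (55)–(56) p.286] -/
theorem exists_expansion_D (hC : QuadAnalytic Ct C₂ R) (hCa : AnalyticOnNhd ℂ Ct {Y : 𝒴 | ‖Y‖ < R})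
    (hC₂ : 0 ≤ C₂) (hb : 0 ≤ b) (hHop : ∀ X, ‖hop X‖ ≤ b * ‖X‖) (hq : 9 * C₂ * b * ε < 1)
    (hRC : 3 * ε ≤ R) (hDball : ∀ B : 𝒴, ‖B‖ < ε → D B ∈ closedBall (0 : 𝒳) (4 * C₂ * ε ^ 2))
    (hDfix : ∀ B : 𝒴, ‖B‖ < ε → Ct (B - hop (D B)) = D B) (hε : 0 < ε) :
    ∃ p : FormalMultilinearSeries ℂ 𝒴 𝒳, HasFPowerSeriesAt D p 0 ∧ p 0 = 0 ∧ p 1 = 0 := by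
  obtain ⟨p, hp⟩ := analyticAt_Dt hC hCa hC₂ hb hHop hq hRC hDball hDfix (B₀ := (0 : 𝒴)) (by simpa using hε)
  exact ⟨p, hp, coeff_zero_one_Dt hC hCa hC₂ hb hHop hq hRC hDball hDfix hε hp⟩

/-- **THE RECURSIVE SYSTEM (56), packaged** for the Sect. C scheme: for a functional `C` with the quadratic bound (44)
and analytic on `‖Y‖ < R`, an operator `H` with `‖H‖ ≤ b` and `9C₂bε < 1`, `3ε ≤ R` (p. 286), and any selector `D` of
the fixed point of (49)–(50) on `‖A′‖ < ε`, there are expansions `p` of `D` and `q` of `C` at `0`, both beginning with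
second-order terms, such that `q ∘ (ι − H·p)` is an expansion of `D` at `0` ((56)), the order-`n` term of
`q ∘ (ι − H·p)` depends on `p` only below order `n` (THE RECURSION), the homogeneous terms of `D` satisfy the system,
and `D^{(2)}(A′) = C_j^{(2)}(LʲηA′)` (`= C^{(2)}(A′)` in print's abbreviation; order two). [cite: Balaban1985Variational, (56) p.286] -/
theorem recursive_system (hC : QuadAnalytic Ct C₂ R) (hCa : AnalyticOnNhd ℂ Ct {Y : 𝒴 | ‖Y‖ < R})
    (hC₂ : 0 ≤ C₂) (hb : 0 ≤ b) (hHop : ∀ X, ‖hop X‖ ≤ b * ‖X‖) (hq : 9 * C₂ * b * ε < 1)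
    (hRC : 3 * ε ≤ R) (hDball : ∀ B : 𝒴, ‖B‖ < ε → D B ∈ closedBall (0 : 𝒳) (4 * C₂ * ε ^ 2))
    (hDfix : ∀ B : 𝒴, ‖B‖ < ε → Ct (B - hop (D B)) = D B) (hε : 0 < ε)
    (H : 𝒳 →L[ℂ] 𝒴) (hH : ∀ X, H X = hop X) :
    ∃ p q : FormalMultilinearSeries ℂ 𝒴 𝒳,
      HasFPowerSeriesAt D p 0 ∧ HasFPowerSeriesAt Ct q 0 ∧ (p 0 = 0 ∧ p 1 = 0) ∧ (q 0 = 0 ∧ q 1 = 0) ∧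
      HasFPowerSeriesAt D
        (q.comp ((ContinuousLinearMap.id ℂ 𝒴).fpowerSeries 0 - H.compFormalMultilinearSeries p)) 0 ∧
      (∀ (n : ℕ) (s : FormalMultilinearSeries ℂ 𝒴 𝒳), (∀ m < n, s m = p m) →
        q.comp ((ContinuousLinearMap.id ℂ 𝒴).fpowerSeries 0 - H.compFormalMultilinearSeries p) n =
          q.comp ((ContinuousLinearMap.id ℂ 𝒴).fpowerSeries 0 - H.compFormalMultilinearSeries s) n) ∧
      (∀ (n : ℕ) (A : 𝒴), p n (fun _ => A) =
        (q.comp ((ContinuousLinearMap.id ℂ 𝒴).fpowerSeries 0 - H.compFormalMultilinearSeries p)) n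
          (fun _ => A)) ∧
      ∀ A : 𝒴, p 2 (fun _ => A) = q 2 (fun _ => A) := by
  have hR : 0 < R := by linarith
  obtain ⟨p, hp, hp01⟩ := exists_expansion_D hC hCa hC₂ hb hHop hq hRC hDball hDfix hε
  obtain ⟨q, hq', hq01⟩ := exists_expansion_Ct hC hCa hR
  exact ⟨p, q, hp, hq', hp01, hq01, hasFPowerSeriesAt_recursive hC hC₂ hb hHop hq hRC hDball hDfix hε H hH hp hq',
    fun n s hs => coeff_recursion hC hR H hq' p s hs,
    fun n A => coeff_diag_recursive hC hC₂ hb hHop hq hRC hDball hDfix hε H hH hp hq' n A,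
    fun A => coeff_two_diag_of_expansions hC hC₂ hb hHop hq hRC hDball hDfix hε H hH hp hq' A⟩

end Package

/-! ## §3  The instance for the solution-as-a-function `B11Prop3Model.Dfix` under the located Sect. C inputs -/

section Dfix

open B11Prop3Model (Dfix Dfix_ball Dfix_fix Inputs)

/-- **THE RECURSIVE SYSTEM (56) FOR `D(A′)` = `B11Prop3Model.Dfix Ct hop C₂`**, the solution of (49) as a function
under the located Sect. C inputs (44)/(46)/(72) (`B11Prop3Model.Inputs Ct hop C₂ C₃ B₀ c₄`), the analyticity letter of
(44) ([4] Prop. 7 «analytic function») in Fréchet form `AnalyticOnNhd ℂ Ct {‖Y‖ < 2c₄}` (as in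
`B12LinearizAnalytic267`; `Inputs.contDiff` records complex `C¹` only, and «holomorphic on a Banach ball ⟹ analytic»
is not in Mathlib beyond one variable), and the smallness of p. 286 (`9C₂B₀ε₃ < 1`, `3ε₃ ≤ 2c₄`, `ε₃ > 0`), with
`H = Inputs.hopL`: expansions `p` of `D` and `q` of `C` at `0` beginning with second-order terms, (56) as
`HasFPowerSeriesAt D (q ∘ (ι − H·p)) 0`, the recursion, the system for the homogeneous terms, and
`D^{(2)}(A′) = C_j^{(2)}(LʲηA′)` (`= C^{(2)}(A′)` in print's abbreviation). [cite: Balaban1985Variational, (56) p.286] -/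
theorem dfix_recursive_system {C₃ B₀ c₄ ε₃ : ℝ} (hin : Inputs Ct hop C₂ C₃ B₀ c₄)
    (hCa : AnalyticOnNhd ℂ Ct {Y : 𝒴 | ‖Y‖ < 2 * c₄}) (hC₂ : 0 ≤ C₂) (hB₀ : 0 ≤ B₀)
    (hε₃ : 0 < ε₃) (hq : 9 * C₂ * B₀ * ε₃ < 1) (hRC : 3 * ε₃ ≤ 2 * c₄) :
    ∃ p q : FormalMultilinearSeries ℂ 𝒴 𝒳,
      HasFPowerSeriesAt (Dfix Ct hop C₂) p 0 ∧ HasFPowerSeriesAt Ct q 0 ∧ (p 0 = 0 ∧ p 1 = 0) ∧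
      (q 0 = 0 ∧ q 1 = 0) ∧
      HasFPowerSeriesAt (Dfix Ct hop C₂)
        (q.comp ((ContinuousLinearMap.id ℂ 𝒴).fpowerSeries 0 - hin.hopL.compFormalMultilinearSeries p)) 0 ∧
      (∀ (n : ℕ) (s : FormalMultilinearSeries ℂ 𝒴 𝒳), (∀ m < n, s m = p m) →
        q.comp ((ContinuousLinearMap.id ℂ 𝒴).fpowerSeries 0 - hin.hopL.compFormalMultilinearSeries p) n =
          q.comp ((ContinuousLinearMap.id ℂ 𝒴).fpowerSeries 0 - hin.hopL.compFormalMultilinearSeries s) n) ∧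
      (∀ (n : ℕ) (A : 𝒴), p n (fun _ => A) =
        (q.comp ((ContinuousLinearMap.id ℂ 𝒴).fpowerSeries 0 - hin.hopL.compFormalMultilinearSeries p)) n
          (fun _ => A)) ∧
      ∀ A : 𝒴, p 2 (fun _ => A) = q 2 (fun _ => A) :=
  recursive_system hin.quadAnalytic hCa hC₂ hB₀ hin.norm_H hq hRC
    (Dfix_ball hin.quadAnalytic hC₂ hB₀ hin.norm_H hq hRC) (Dfix_fix hin.quadAnalytic hC₂ hB₀ hin.norm_H hq hRC)
    hε₃ hin.hopL hin.hopL_apply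

omit [CompleteSpace 𝒴] in
/-- **Order three of (56) for `D(A′)` = `B11Prop3Model.Dfix Ct hop C₂`** — *«D^{(3)}(A′) = C_j^{(3)}(LʲηA′) −
2C_j^{(2)}(LʲηA′, LʲηHC^{(2)}(A′))»*: for EVERY expansion `p` of `D` and `q` of `C` at `0` (under the located inputs and
the smallness of p. 286; no analyticity of `C` beyond `q`), `p 3 (A′, A′, A′) = q 3 (A′, A′, A′) − (q 2 (A′, HB) +
q 2 (HB, A′))`, `B = p 2 (A′, A′)`, with `H = Inputs.hopL`. [cite: Balaban1985Variational, (56) p.286] -/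
theorem dfix_coeff_three_diag {C₃ B₀ c₄ ε₃ : ℝ} (hin : Inputs Ct hop C₂ C₃ B₀ c₄) (hC₂ : 0 ≤ C₂) (hB₀ : 0 ≤ B₀)
    (hε₃ : 0 < ε₃) (hq : 9 * C₂ * B₀ * ε₃ < 1) (hRC : 3 * ε₃ ≤ 2 * c₄)
    {p q : FormalMultilinearSeries ℂ 𝒴 𝒳} (hp : HasFPowerSeriesAt (Dfix Ct hop C₂) p 0)
    (hq' : HasFPowerSeriesAt Ct q 0) (A : 𝒴) :
    p 3 (fun _ => A) =
      q 3 (fun _ => A) - (q 2 ![A, hin.hopL (p 2 fun _ => A)] + q 2 ![hin.hopL (p 2 fun _ => A), A]) :=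
  coeff_three_diag_of_expansions hin.quadAnalytic hC₂ hB₀ hin.norm_H hq hRC
    (Dfix_ball hin.quadAnalytic hC₂ hB₀ hin.norm_H hq hRC) (Dfix_fix hin.quadAnalytic hC₂ hB₀ hin.norm_H hq hRC)
    hε₃ hin.hopL hin.hopL_apply hp hq' A

end Dfix

end Literature.MathematicalPhysics.QuantumFieldTheory.Balaban1983to89.B11Eq56RecursiveSystem
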